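import Summits.KontsevichZagierPeriods.Zeta5Search.Certificates.VIML3Sum
import Summits.KontsevichZagierPeriods.Zeta5Search.Certificates.VIML3Small
import Summits.KontsevichZagierPeriods.Zeta5Search.Certificates.VIML3BridgeK3
import HarnessLib

/-!
# ζ(5) search — brown9 LEVEL 3: `VIMLeadingRecurrence` modulo the two `L`-relations (cell `pub-zeta5`, certifier `cert-1`)

HONEST FRAMING: systematic search; recurrence certificates; no irrationality claim unless certified.

**`vimLeadingRecurrence_of_L`**: if the lane's level-2 relations (L-K3) and (L-NK) for the inner triple sum
`L = VIMInner.Lsum` hold for every level `m ≥ 12` and every rational `k₃` (`VIML3Defs.LK3At m`, `LNKAt m` — their kernel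
replay is cert-2's `ModRedLK3*` line; the two `R`-relations are already tree theorems), then the cell's typed conjecture
`Families.CellularVIMRecurrenceLaws.VIMLeadingRecurrence` holds: the order-4, degree-19 operator `P` found by fam-brown9
annihilates the leading coefficients `A(n) = leading (basic n) (basic n)` of the "vanishing in the middle" family for ALL `n`.
Assembly of: `VIMOuterSum` (factorisation of the 6-fold sum), `VIML3Transfer*` (module action), `VIML3CertM*` (the seat's
exact certificate, 6 × 2850 terms), `VIML3Fin*` (six coordinate identities, one Kronecker evaluation each), `VIML3Termwise`,
`VIML3Sum` (`n ≥ 12`) and `VIML3Small` (`n < 12`, kernel values `A(0..15)`). With cert-2's kernel theorem for (L-K3)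
(`VIML3BridgeK3.LK3At_holds`) only (L-NK) remains an input: **`vimLeadingRecurrence_of_LNK`**. No named facts.
-/

namespace Summit.KontsevichZagierPeriods.Zeta5Search.Certificates

namespace VIMInner.L3

open Families.CellularVIMRecurrenceLaws (VIMLeadingRecurrence)

/-- **LEVEL 3 of the brown9 programme, modulo (L-K3)/(L-NK)**: the cell's order-4 recurrence for `A(n)` holds for every `n`,
given the two level-2 relations of the triple sum `L` from level `12` on. -/
theorem vimLeadingRecurrence_of_L (hK : ∀ m, 12 ≤ m → LK3At m) (hN : ∀ m, 12 ≤ m → LNKAt m) :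
    VIMLeadingRecurrence := by
  intro n
  rcases Nat.lt_or_ge n 12 with h | h
  · exact opApply_A_small n h
  · exact recurrence_of_L n h (fun m hm => hK m (le_trans h hm)) (fun m hm => hN m (le_trans h hm))

/-- **LEVEL 3 modulo (L-NK) alone**: with (L-K3) a tree theorem (cert-2, `LK3At_holds`), the order-4 recurrence for `A(n)`
holds for every `n` as soon as the lane's `n`-shift relation (L-NK) of the triple sum is available from level `12` on. -/
theorem vimLeadingRecurrence_of_LNK (hN : ∀ m, 12 ≤ m → LNKAt m) : VIMLeadingRecurrence :=
  vimLeadingRecurrence_of_L (fun m hm => LK3At_holds m (by omega)) hN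

end VIMInner.L3

end Summit.KontsevichZagierPeriods.Zeta5Search.Certificates
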